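import Mathlib.CategoryTheory.Galois.Full
import Literature.AnabelianGeometry.SemiGraphs.SubCoverticialOfObject
import Literature.AnabelianGeometry.SemiGraphs.LevelEdgesOfObject
import Literature.AnabelianGeometry.SemiGraphs.Coverticial
import Literature.AnabelianGeometry.SemiGraphs.Commensurability
import Literature.AnabelianGeometry.SemiGraphs.BObjDegree
import Literature.AnabelianGeometry.SemiGraphs.TreeFixedPairProofs
import Literature.AnabelianGeometry.Anabelioids.TerminalCoproductComponents
import Literature.AnabelianGeometry.Anabelioids.TrivialObjectCard
import Literature.AnabelianGeometry.Anabelioids.TrivialObjectSections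
import HarnessLib

/-!
# [SemiAnbd] Example 2.8, coverticial half — the sufficiency direction, PROVED

Mochizuki, *Semi-graphs of anabelioids*, Publ. RIMS **42** (2006) 221–322, §2, Example 2.8, author's
manuscript p. 31 [cite: MochizukiSemiAnbd2006, Ex. 2.8 p.31]: if `𝒢_e` is trivial for all edges `e`,
"a closed edge abutting to vertices `v`, `w` is sub-coverticial … if [and only if] both `Π_v` and
`Π_w` are nontrivial".

PROOF-ONLY companion (abc-iut cell, layer L3, row W4-31 of abc-iut-L3-lead α6-4; statement owner
abc-iut-L3-t1, `Coverticial.lean` rev 4, named fact `SemiGraphOfAnabelioids.example_2_8_coverticial`,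
FACT-LIST F-1474).  No definition is introduced and no statement of `Coverticial.lean` is altered.
This file proves the SUFFICIENCY direction of the first conjunct AS TYPED — for every closed edge
`e` joining `v` to `w` (the case of a loop `v = w` included):

* `SemiGraphOfAnabelioids.isSubCoverticial_of_nontrivial` — trivial edge anabelioids, `e` joins
  `v`, `w`, `Π_v` and `Π_w` nontrivial (at every basepoint) ⇒ `e` is sub-coverticial.

Construction (print: "one verifies immediately"): choose connected objects `X_v`, `X_w` of `𝒢_v`,
`𝒢_w` with at least two fibre points (they exist exactly because `Π_v`, `Π_w` are nontrivial,
`Anabelioids.exists_isConnected_ne_of_nontrivial`), put `N := |X_v| · |X_w|`, and take the object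
`A = {S_u, T_f, ψ_β}` of `B(𝒢)` with `S_u := X_u ⨿ (N − |X_u|) · 1` at `u ∈ {v, w}`, `S_u := 1 ⨿ (N−1) · 1`
elsewhere, `T_f := N · 1` for every edge `f`, and — `Π_f` being trivial, every bijection of fibres
is an isomorphism (`Anabelioids.exists_iso_map_eq_of_subsingleton_aut`) — gluing isomorphisms `ψ_β`
chosen so that along EVERY branch `β` of `e` the sheets `0` and `1` of `T_e` lie under the component
`X_u ↪ S_u`.  In print's covering `𝒢_A → 𝒢` attached to `A` (abc-iut-L3-t5's `BObj.coveringGraph`,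
a finite étale covering in the full sense by abc-iut-w4-d071's
`BObj.coveringHom_isFiniteEtaleCoveringGlobal`) the edges `(e, 0) ≠ (e, 1)` are closed and abut to
the same vertices (abc-iut-L6-t18's `componentOver_eq_of_mem`), i.e. they are coverticial.

The NECESSITY direction is false as typed at a loop (finding d075-S1 of abc-iut-w4-d075: the
connected double covering of a loop with trivial `𝒢_e` has two coverticial edges whatever `Π_v`);
the named fact therefore stays open-as-typed (ruling κ3-1) and nothing here asserts it.
Honest framing: typed ≠ discharged; nothing here takes a side on [IUTchIII] Cor. 3.12.
-/

namespace Literature.AnabelianGeometry.Anabelioids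

open CategoryTheory CategoryTheory.Limits CategoryTheory.PreGaloisCategory

universe w u₂ u₁

variable {C : Type u₁} [Category.{u₂} C] [GaloisCategory C] (F : C ⥤ FintypeCat.{w}) [FiberFunctor F]

/-! ### Two Galois-category lemmas -/

/-- **A connected anabelioid with nontrivial fundamental group has a connected finite étale covering
of degree `≥ 2`**: if `Aut F` is nontrivial there is a connected object with two distinct fibre points
(a non-identity automorphism of the fibre functor moves some point; pass to the connected component
through it). [cite: SGA1, Exp. V §4] -/
theorem exists_isConnected_ne_of_nontrivial [Nontrivial (Aut F)] :
    ∃ (Z : C) (z₀ z₁ : F.obj Z), PreGaloisCategory.IsConnected Z ∧ z₀ ≠ z₁ := by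
  obtain ⟨σ, hσ⟩ := exists_ne (1 : Aut F)
  have hmove : ∃ (X : C) (x : F.obj X), σ.hom.app X x ≠ x := by
    by_contra h
    push Not at h
    apply hσ
    apply Iso.ext
    apply NatTrans.ext
    funext X
    exact FintypeCat.hom_ext _ _ fun x => by rw [h X x]; rfl
  obtain ⟨X, x, hx⟩ := hmove
  obtain ⟨Z, i, z, hz, hZ, hi⟩ := fiber_in_connected_component F X x
  refine ⟨Z, z, σ.hom.app Z z, hZ, fun hzz => hx ?_⟩
  have hnat := mulAction_naturality F σ i z
  rw [mulAction_def, mulAction_def, hz] at hnat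
  rw [hnat, ← hzz, hz]

/-- **When the fundamental group is trivial, every bijection of fibres is an isomorphism**: for
`Aut F` trivial and a bijection `e : F(X) ≃ F(Y)` there is an isomorphism `i : X ≅ Y` with `F(i) = e`
(Grothendieck's Galois theory: `functorToAction F` is fully faithful and every map of fibres is
equivariant for the trivial group). [cite: SGA1, Exp. V §4] -/
theorem exists_iso_map_eq_of_subsingleton_aut [Subsingleton (Aut F)] {X Y : C}
    (e : F.obj X ≃ F.obj Y) : ∃ i : X ≅ Y, ∀ x, F.map i.hom x = e x := by
  let i' : (functorToAction F).obj X ≅ (functorToAction F).obj Y :=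
    Action.mkIso (FintypeCat.equivEquivIso e) fun g => by
      have hg : g = 1 := Subsingleton.elim _ _
      subst hg
      simp only [map_one, End.one_def, Category.id_comp, Category.comp_id]
  refine ⟨(functorToAction F).preimageIso i', fun x => ?_⟩
  have hmap : F.map ((functorToAction F).preimageIso i').hom = i'.hom.hom := by
    rw [Functor.preimageIso_hom, ← functorToAction_map, Functor.map_preimage]
  rw [hmap]
  rfl

/-- Elementary: a finite set with two distinct points `x₀ ≠ x₁` and `N` elements admits a bijection
with `Fin N` sending `x₀ ↦ 0`, `x₁ ↦ 1`. [folklore] -/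
private theorem exists_equiv_fin_apply_eq_zero_one {α : Type*} [Finite α] {N : ℕ} (hα : Nat.card α = N)
    (h2 : 2 ≤ N) {x₀ x₁ : α} (hx : x₀ ≠ x₁) :
    ∃ ε : α ≃ Fin N, ε x₀ = ⟨0, by omega⟩ ∧ ε x₁ = ⟨1, by omega⟩ := by
  classical
  let ε' : α ≃ Fin N := Finite.equivFinOfCardEq hα
  let ε₁ : α ≃ Fin N := ε'.trans (Equiv.swap (ε' x₀) ⟨0, by omega⟩)
  have h₁ : ε₁ x₀ = ⟨0, by omega⟩ := by simp [ε₁]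
  let ε : α ≃ Fin N := ε₁.trans (Equiv.swap (ε₁ x₁) ⟨1, by omega⟩)
  refine ⟨ε, ?_, by simp [ε]⟩
  have hne : ε₁ x₀ ≠ ε₁ x₁ := fun h => hx (ε₁.injective h)
  change Equiv.swap (ε₁ x₁) ⟨1, by omega⟩ (ε₁ x₀) = _
  rw [h₁] at hne ⊢
  exact Equiv.swap_apply_of_ne_of_ne hne (by simp [Fin.ext_iff])

end Literature.AnabelianGeometry.Anabelioids

namespace Literature.AnabelianGeometry.SemiGraphs

open CategoryTheory CategoryTheory.Limits CategoryTheory.PreGaloisCategory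
open Literature.AnabelianGeometry.Anabelioids

universe v₁ u₁ u

/-! ### Incidence in the total semi-graph of fibre data -/

namespace SemiGraph.FibreData

variable {G : SemiGraph.{u}} (D : G.FibreData)

/-- In the total semi-graph of fibre data `D`, let `c₀, c₁` be uniform families of components over
the edges.  If along every branch `β` (abutting to `u`) of the edge `e` the components `c₀ (e β)`,
`c₁ (e β)` lie under the same component over `u`, then every vertex met by the edge `(e, c₀ e)` is met
by `(e, c₁ e)`. [cite: MochizukiSemiAnbd2006, Def. 2.2(i) p.23] -/
theorem edgeAbuts_of_sigma_eq (c₀ c₁ : ∀ f : G.Edge, D.FE f) (e : G.Edge)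
    (H : ∀ (β : G.Branch), G.edgeOf β = e → ∀ (u : G.Vertex) (h : G.abuts β = some u),
      D.σ β u h (c₀ (G.edgeOf β)) = D.σ β u h (c₁ (G.edgeOf β)))
    {vc : D.total.Vertex} (hv : D.total.EdgeAbuts ⟨e, c₀ e⟩ vc) : D.total.EdgeAbuts ⟨e, c₁ e⟩ vc := by
  obtain ⟨⟨β, d⟩, hβe, hab⟩ := hv
  have hb : G.edgeOf β = e := congrArg Sigma.fst hβe
  subst hb
  have hd : d = c₀ (G.edgeOf β) := eq_of_heq (Sigma.mk.inj_iff.mp hβe).2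
  subst hd
  obtain ⟨u, p⟩ := vc
  have hgb : G.abuts β = some u := D.abuts_of_total_abuts hab
  refine ⟨⟨β, c₁ (G.edgeOf β)⟩, rfl, ?_⟩
  rw [D.total_abuts_of_abuts hgb] at hab ⊢
  rw [← H β rfl u hgb]
  exact hab

end SemiGraph.FibreData

/-! ### The sufficiency direction of [SemiAnbd] Example 2.8 (coverticial half) -/

namespace SemiGraphOfAnabelioids

variable {𝒢 : SemiGraphOfAnabelioids.{v₁, u₁, u}}

/-- Fibre images of `Subobject.mk f` and of `f` agree. [folklore] -/
private theorem range_map_mk_arrow {C : Type u₁} [Category.{v₁} C] (G : C ⥤ FintypeCat.{v₁})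
    {Y Z : C} (f : Z ⟶ Y) [Mono f] :
    Set.range (G.map (Subobject.mk f).arrow) = Set.range (G.map f) := by
  ext y
  constructor
  · rintro ⟨p, rfl⟩
    refine ⟨G.map (Subobject.underlyingIso f).hom p, ?_⟩
    rw [← FintypeCat.comp_apply, ← G.map_comp, Subobject.underlyingIso_hom_comp_eq_mk]
  · rintro ⟨z, rfl⟩
    refine ⟨G.map (Subobject.underlyingIso f).inv z, ?_⟩
    rw [← FintypeCat.comp_apply, ← G.map_comp, Subobject.underlyingIso_arrow]

/-- **[SemiAnbd] Example 2.8, coverticial half, sufficiency** (p. 31: "if `𝒢_e` is trivial for all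
edges `e` … a closed edge abutting to vertices `v`, `w` is sub-coverticial if [and only if] both `Π_v`
and `Π_w` are nontrivial" — the "if" direction, loops `v = w` included): for `𝒢` with trivial edge
anabelioids and a closed edge `e` joining `v` to `w`, if `Π_v` and `Π_w` are nontrivial (at every
basepoint) then `e` is sub-coverticial. [cite: MochizukiSemiAnbd2006, Ex. 2.8 p.31] -/
theorem isSubCoverticial_of_nontrivial (hE : 𝒢.HasTrivialEdgeAnabelioids)
    {e : 𝒢.graph.Edge} {v w : 𝒢.graph.Vertex} (hj : 𝒢.graph.Joins e v w)
    (hv : ∀ (F : 𝒢.V v ⥤ FintypeCat.{v₁}) [FiberFunctor F], Nontrivial (Aut F))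
    (hw : ∀ (F : 𝒢.V w ⥤ FintypeCat.{v₁}) [FiberFunctor F], Nontrivial (Aut F)) :
    𝒢.IsSubCoverticial e := by
  classical
  obtain ⟨b₁, b₂, hb12, hb₁, hb₂, ha₁, ha₂⟩ := hj
  have he : 𝒢.graph.IsClosedEdge e := SemiGraph.isClosedEdge_of_abuts hb12 hb₁ hb₂ ha₁ ha₂
  -- every branch of `e` abuts to `v` or to `w`
  have hbr : ∀ β : 𝒢.graph.Branch, 𝒢.graph.edgeOf β = e → ∀ u, 𝒢.graph.abuts β = some u →
      u = v ∨ u = w := by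
    intro β hβ u hu
    obtain ⟨c₁, c₂, -, -, -, hall⟩ := 𝒢.graph.two_branches e
    have h1 := hall b₁ hb₁
    have h2 := hall b₂ hb₂
    rcases hall β hβ with rfl | rfl
    · rcases h1 with rfl | rfl
      · left; rw [ha₁] at hu; exact (Option.some.inj hu).symm
      · rcases h2 with rfl | rfl
        · right; rw [ha₂] at hu; exact (Option.some.inj hu).symm
        · exact absurd rfl hb12
    · rcases h1 with rfl | rfl
      · rcases h2 with rfl | rfl
        · exact absurd rfl hb12
        · right; rw [ha₂] at hu; exact (Option.some.inj hu).symm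
      · left; rw [ha₁] at hu; exact (Option.some.inj hu).symm
  -- basepoints
  let FV : ∀ u : 𝒢.graph.Vertex, 𝒢.V u ⥤ FintypeCat.{v₁} := fun u =>
    GaloisCategory.getFiberFunctor (𝒢.V u)
  let FE : ∀ f : 𝒢.graph.Edge, 𝒢.E f ⥤ FintypeCat.{v₁} := fun f =>
    GaloisCategory.getFiberFunctor (𝒢.E f)
  -- Step 1: at every vertex a connected object, with two fibre points at `v` and at `w`, trivial elsewhere
  have hC : ∀ u : 𝒢.graph.Vertex, ∃ X : 𝒢.V u, PreGaloisCategory.IsConnected X ∧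
      ((u = v ∨ u = w) → 2 ≤ Nat.card ((FV u).obj X)) ∧ Nat.card ((FV u).obj X) ≤
        (if u = v ∨ u = w then Nat.card ((FV u).obj X) else 1) := by
    intro u
    by_cases hu : u = v ∨ u = w
    · haveI : Nontrivial (Aut (FV u)) := by
        rcases hu with rfl | rfl
        · exact hv _
        · exact hw _
      obtain ⟨X, x₀, x₁, hX, hne⟩ := exists_isConnected_ne_of_nontrivial (FV u)
      refine ⟨X, hX, fun _ => ?_, by rw [if_pos hu]⟩
      haveI : Fintype ((FV u).obj X) := Fintype.ofFinite _
      rw [Nat.card_eq_fintype_card]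
      exact Fintype.one_lt_card_iff_nontrivial.mpr ⟨x₀, x₁, hne⟩
    · refine ⟨⊤_ (𝒢.V u), isConnected_terminal, fun h => (hu h).elim, ?_⟩
      rw [if_neg hu]
      obtain ⟨eq⟩ := nonempty_equiv_fiber_terminal_punit (FV u)
      rw [Nat.card_congr eq, Nat.card_unique]
  choose X hXconn hXtwo hXle using hC
  -- cardinalities
  let c : 𝒢.graph.Vertex → ℕ := fun u => Nat.card ((FV u).obj (X u))
  have hcv : 2 ≤ c v := hXtwo v (Or.inl rfl)
  have hcw : 2 ≤ c w := hXtwo w (Or.inr rfl)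
  let N : ℕ := c v * c w
  have hN : 2 ≤ N := le_trans hcv (Nat.le_mul_of_pos_right _ (by omega))
  have hcle : ∀ u, c u ≤ N := by
    intro u
    have h := hXle u
    by_cases hu : u = v ∨ u = w
    · rcases hu with rfl | rfl
      · exact Nat.le_mul_of_pos_right _ (by omega)
      · exact Nat.le_mul_of_pos_left _ (by omega)
    · rw [if_neg hu] at h
      exact le_trans h (by omega)
  -- Step 2: the object `A = {S_u, T_f, ψ_β}` of `B(𝒢)`
  let S : ∀ u : 𝒢.graph.Vertex, 𝒢.V u := fun u =>
    X u ⨿ (∐ fun _ : Fin (N - c u) => ⊤_ (𝒢.V u))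
  let T : ∀ f : 𝒢.graph.Edge, 𝒢.E f := fun f => ∐ fun _ : Fin N => ⊤_ (𝒢.E f)
  -- the point of the fibre of `1` and the sheets of `T_f`
  have htE : ∀ f : 𝒢.graph.Edge, Nonempty ((FE f).obj (⊤_ (𝒢.E f))) := fun f =>
    (nonempty_equiv_fiber_terminal_punit (FE f)).map fun eq => eq.symm PUnit.unit
  let tE : ∀ f : 𝒢.graph.Edge, (FE f).obj (⊤_ (𝒢.E f)) := fun f => (htE f).some
  let sheet : ∀ f : 𝒢.graph.Edge, Fin N → (FE f).obj (T f) := fun f s =>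
    (FE f).map (Sigma.ι (fun _ : Fin N => ⊤_ (𝒢.E f)) s) (tE f)
  have hsheet : ∀ f, Function.Bijective (sheet f) := fun f =>
    ⟨TrivialObj.map_ι_injective (FE f) (tE f), fun x => by
      obtain ⟨j, rfl⟩ := TrivialObj.exists_eq_map_ι (FE f) (tE f) x
      exact ⟨j, rfl⟩⟩
  -- the fibre of `S_u` has `N` points at every basepoint
  have hcardS : ∀ (u : 𝒢.graph.Vertex) (G : 𝒢.V u ⥤ FintypeCat.{v₁}) [FiberFunctor G],
      Nat.card (G.obj (S u)) = N := by
    intro u G _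
    change Nat.card (G.obj (X u ⨿ (∐ fun _ : Fin (N - c u) => ⊤_ (𝒢.V u)))) = N
    rw [card_fiber_coprod_eq_sum, TrivialObj.card_fiber, Nat.card_fin,
      card_fiber_eq_of_fiberFunctor G (FV u)]
    have := hcle u
    change c u + (N - c u) = N
    omega
  -- the gluing bijections: along a branch at `u`, two points of the fibre of `X_u ↪ S_u` go to the
  -- sheets `0`, `1` whenever `X_u` has two fibre points
  have hε : ∀ (β : 𝒢.graph.Branch) (u : 𝒢.graph.Vertex) (h : 𝒢.graph.abuts β = some u),
      ∃ ε : ((𝒢.pull β u h).pullback ⋙ FE (𝒢.graph.edgeOf β)).obj (S u) ≃ Fin N,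
        2 ≤ c u → ∃ x₀ x₁,
          x₀ ∈ Set.range (((𝒢.pull β u h).pullback ⋙ FE (𝒢.graph.edgeOf β)).map
            (coprod.inl : X u ⟶ S u)) ∧
          x₁ ∈ Set.range (((𝒢.pull β u h).pullback ⋙ FE (𝒢.graph.edgeOf β)).map
            (coprod.inl : X u ⟶ S u)) ∧
          ε x₀ = ⟨0, by omega⟩ ∧ ε x₁ = ⟨1, by omega⟩ := by
    intro β u h
    let G := (𝒢.pull β u h).pullback ⋙ FE (𝒢.graph.edgeOf β)
    haveI : FiberFunctor G := fiberFunctor_comp_of_exact _ _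
    have hcard : Nat.card (G.obj (S u)) = N := hcardS u G
    by_cases hu : 2 ≤ c u
    · -- two distinct points in the fibre of `X_u`, hence of `X_u ↪ S_u`
      have hcX : 2 ≤ Nat.card (G.obj (X u)) := by
        rw [card_fiber_eq_of_fiberFunctor G (FV u)]; exact hu
      haveI : Fintype (G.obj (X u)) := Fintype.ofFinite _
      rw [Nat.card_eq_fintype_card] at hcX
      obtain ⟨y₀, y₁, hy⟩ := Fintype.one_lt_card_iff_nontrivial.mp hcX
      have hinj : Function.Injective (G.map (coprod.inl : X u ⟶ S u)) :=
        ConcreteCategory.injective_of_mono_of_preservesPullback (G.map coprod.inl)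
      obtain ⟨ε, h₀, h₁⟩ := exists_equiv_fin_apply_eq_zero_one hcard hN
        (x₀ := G.map coprod.inl y₀) (x₁ := G.map coprod.inl y₁) (fun h => hy (hinj h))
      exact ⟨ε, fun _ => ⟨_, _, ⟨y₀, rfl⟩, ⟨y₁, rfl⟩, h₀, h₁⟩⟩
    · exact ⟨Finite.equivFinOfCardEq hcard, fun h => (hu h).elim⟩
  choose ε hε using hε
  -- the gluing isomorphisms `ψ_β : β^* S_u ⥲ T_f` realising `sheet ∘ ε_β` on fibres
  have hψ : ∀ (β : 𝒢.graph.Branch) (u : 𝒢.graph.Vertex) (h : 𝒢.graph.abuts β = some u),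
      ∃ ψ : (𝒢.pull β u h).pullback.obj (S u) ≅ T (𝒢.graph.edgeOf β),
        ∀ x, (FE (𝒢.graph.edgeOf β)).map ψ.hom x = sheet (𝒢.graph.edgeOf β) (ε β u h x) := by
    intro β u h
    haveI : Subsingleton (Aut (FE (𝒢.graph.edgeOf β))) := hE.subsingleton _ _
    exact exists_iso_map_eq_of_subsingleton_aut (FE (𝒢.graph.edgeOf β))
      ((ε β u h).trans (Equiv.ofBijective _ (hsheet (𝒢.graph.edgeOf β))))
  choose ψ hψ using hψ
  let A : 𝒢.BObj := ⟨S, T, ψ⟩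
  -- Step 3: the sheet components of `T_f` and the component `X_u ↪ S_u`
  let Qsh : ∀ f : 𝒢.graph.Edge, Fin N → π₀Obj (A.T f) := fun f s =>
    ⟨Subobject.mk (Sigma.ι (fun _ : Fin N => ⊤_ (𝒢.E f)) s), isConnected_subobjectMk_sigma_ι _ s⟩
  let P : ∀ u : 𝒢.graph.Vertex, π₀Obj (A.S u) := fun u =>
    ⟨Subobject.mk (coprod.inl : X u ⟶ S u), by
      haveI := hXconn u
      exact isConnected_of_iso (Subobject.underlyingIso (coprod.inl : X u ⟶ S u)).symm⟩
  let s₀ : Fin N := ⟨0, by omega⟩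
  let s₁ : Fin N := ⟨1, by omega⟩
  -- along a branch at a vertex with two fibre points, the sheets `0`, `1` lie under `X_u ↪ S_u`
  have hcomp : ∀ (β : 𝒢.graph.Branch) (u : 𝒢.graph.Vertex) (h : 𝒢.graph.abuts β = some u),
      2 ≤ c u → A.componentOver β u h (Qsh (𝒢.graph.edgeOf β) s₀) = P u ∧
        A.componentOver β u h (Qsh (𝒢.graph.edgeOf β) s₁) = P u := by
    intro β u h hu
    let G := (𝒢.pull β u h).pullback ⋙ FE (𝒢.graph.edgeOf β)
    haveI : FiberFunctor G := fiberFunctor_comp_of_exact _ _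
    obtain ⟨x₀, x₁, hx₀, hx₁, hε₀, hε₁⟩ := hε β u h hu
    have key : ∀ (x : G.obj (S u)) (s : Fin N), x ∈ Set.range (G.map (coprod.inl : X u ⟶ S u)) →
        ε β u h x = s → A.componentOver β u h (Qsh (𝒢.graph.edgeOf β) s) = P u := by
      intro x s hx hs
      refine componentOver_eq_of_mem A G β h (FE (𝒢.graph.edgeOf β)) (Iso.refl _) (x := x) ?_ ?_
      · -- `ψ_β` carries `x` to the fibre point of the sheet `s`
        change (FE (𝒢.graph.edgeOf β)).map (ψ β u h).hom ((Iso.refl G).inv.app (S u) x) ∈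
          Set.range ((FE (𝒢.graph.edgeOf β)).map
            (Subobject.mk (Sigma.ι (fun _ : Fin N => ⊤_ (𝒢.E (𝒢.graph.edgeOf β))) s)).arrow)
        rw [range_map_mk_arrow, Iso.refl_inv, NatTrans.id_app, FintypeCat.id_apply, hψ, hs]
        exact ⟨tE _, rfl⟩
      · change x ∈ Set.range (G.map (Subobject.mk (coprod.inl : X u ⟶ S u)).arrow)
        rw [range_map_mk_arrow]
        exact hx
    exact ⟨key x₀ s₀ hx₀ hε₀, key x₁ s₁ hx₁ hε₁⟩
  -- Step 4: the two edges `(e, 0)`, `(e, 1)` of `𝒢_A`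
  let fam : Fin N → ∀ f : 𝒢.graph.Edge, A.fibreData.FE f := fun s f => equivShrink _ (Qsh f s)
  have hσ : ∀ (s : Fin N), (s = s₀ ∨ s = s₁) → ∀ (β : 𝒢.graph.Branch), 𝒢.graph.edgeOf β = e →
      ∀ (u : 𝒢.graph.Vertex) (h : 𝒢.graph.abuts β = some u),
      A.fibreData.σ β u h (fam s (𝒢.graph.edgeOf β)) = equivShrink _ (P u) := by
    intro s hs β hβ u h
    have hu : 2 ≤ c u := by
      rcases hbr β hβ u h with rfl | rfl
      · exact hcv
      · exact hcw
    change equivShrink _ (A.componentOver β u h ((equivShrink _).symm (equivShrink _ (Qsh _ s)))) = _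
    rw [Equiv.symm_apply_apply]
    rcases hs with rfl | rfl
    · rw [(hcomp β u h hu).1]
    · rw [(hcomp β u h hu).2]
  have hiff : ∀ vc : A.fibreData.total.Vertex,
      A.fibreData.total.EdgeAbuts ⟨e, fam s₀ e⟩ vc ↔ A.fibreData.total.EdgeAbuts ⟨e, fam s₁ e⟩ vc := by
    intro vc
    constructor
    · exact A.fibreData.edgeAbuts_of_sigma_eq (fam s₀) (fam s₁) e fun β hβ u h => by
        rw [hσ s₀ (Or.inl rfl) β hβ u h, hσ s₁ (Or.inr rfl) β hβ u h]
    · exact A.fibreData.edgeAbuts_of_sigma_eq (fam s₁) (fam s₀) e fun β hβ u h => by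
        rw [hσ s₀ (Or.inl rfl) β hβ u h, hσ s₁ (Or.inr rfl) β hβ u h]
  have hne : (⟨e, fam s₀ e⟩ : A.fibreData.total.Edge) ≠ ⟨e, fam s₁ e⟩ := by
    intro h
    have h1 : fam s₀ e = fam s₁ e := eq_of_heq (Sigma.mk.inj_iff.mp h).2
    have h2 : Qsh e s₀ = Qsh e s₁ := (equivShrink _).injective h1
    have h3 := subobjectMk_sigma_ι_injective (C := 𝒢.E e) (Fin N) (congrArg Subtype.val h2)
    have h4 : (0 : ℕ) = 1 := congrArg Fin.val h3
    omega
  -- conclusion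
  refine ⟨he, A.coveringGraph, A.coveringHom, A.coveringHom_isFiniteEtaleCoveringGlobal,
    ⟨e, fam s₀ e⟩, ⟨e, fam s₁ e⟩, hne, ⟨?_, ?_, hiff⟩, rfl, rfl⟩
  · change A.fibreData.total.vertCard _ = 2
    rw [A.fibreData.vertCard_total]; exact he
  · change A.fibreData.total.vertCard _ = 2
    rw [A.fibreData.vertCard_total]; exact he

end SemiGraphOfAnabelioids

end Literature.AnabelianGeometry.SemiGraphs
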